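import Literature.NumberTheory.EllipticCurves.IwasawaDualModuleCoeff
import HarnessLib

/-!
# Two commuting locally nilpotent endomorphisms ⟹ a `ℤ_p⟦T₂⟧⟦T₁⟧`-module structure on the dual
# (helper file 6 for crux 2 `GoodLatticeBDPValue`, stmt-BirchSwinnertonDyer-19032, cell `bsd-eis` seat `bsd-eis-k5-c2`; algebraic core of [E₂] `DualData₂ExistsFor`)

The typer's display [E₂] `X1.KellerYinCharTwoVariableDescent.DualData₂ExistsFor` (k5-ty g3,
p439467 §1: "two commuting locally nilpotent endomorphisms `conj_{γ₁} − 1`, `conj_{γ₂} − 1` of a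
`p`-primary group ⇒ a continuous `ℤ_p⟦T₁,T₂⟧`-action on its Pontryagin dual … A KERNEL CONSTRUCTION
owed (RULING L13 (S2) deferred it)") has an ALGEBRAIC core independent of Galois cohomology, proved
here by ITERATING the tree's one-variable constructions:

**Theorem** (`exists_module₂`).  Let `S` be an abelian group, `p` a prime, `ψ₁, ψ₂` COMMUTING
additive endomorphisms of `S` each of which is locally nilpotent on the `p`-primary group `S`
(`IwasawaDual.IsLocNil p ψ_i`).  Then for every abelian group `A`, `Hom(S, A)` carries a
`Module (PowerSeries (PowerSeries ℤ_[p]))`-structure (= `IwasawaAlgebra₂ p`, OUTER variable `T₁`) in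
which `(T₁ • x) s = x (ψ₁ s)`, `(T₂ • x) s = x (ψ₂ s)` (`T₂ = C X`) and constants `c ∈ ℤ_p` (`C (C c)`)
act on `x s` through `ℤ_p → ℤ/p^k` for `p^k s = 0` — exactly the three axioms `toDual_T₁_smul`,
`toDual_T₂_smul`, `toDual_C_smul` of `Rubin1991.DualData₂` (p438535).

Construction: the one-variable structure for `ψ₂` (tree `IwasawaDual.IsLocNil.smulFun`) applied to
`x = id : S →+ S` is a RING ACTION `σ : ℤ_p⟦T⟧ → End(S)` of `B = ℤ_p⟦T₂⟧` on `S` itself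
(`(σ f) s = ∑_{i<N} [T^i]f · ψ₂^i s`, coefficients through `ℤ/p^k`), commuting with `ψ₁`; the tree's
coefficient version `IwasawaDualCoeff.exists_module σ ψ₁` then gives the `B⟦T₁⟧`-structure.  What
remains for [E₂] proper is cohomological: local nilpotence of `conj_{γ_i} − 1` on
`H¹_{nr}(K̃_∞, A)` over the `ℤ_p²`-tower (the two-generator twin of the tree's
`isLocNil_conjUnr_sub_one`, which needs `κ₁|_{ker κ₂}` onto `ℤ_p`) and the commutation of the two
conjugations (commutators lie in `pairKer`).

HONEST FRAMING: generic algebra; closes nothing by itself.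
References: Greenberg, LNM 1716 (1999) §1 (PDF p. 60); Lang, *Cyclotomic Fields I–II* Ch. 5 §1;
Rubin 1991 §4 p. 36 ("Λ = ℤ_p[[𝒢]] … a power series ring in 2 variables").
-/

-- the summit namespace `Summit.BirchSwinnertonDyer.BirchSwinnertonDyer` repeats the problem name by design (D-0017)
set_option linter.dupNamespace false
set_option autoImplicit false

noncomputable section

open Finset PowerSeries Literature.NumberTheory.EllipticCurves

namespace Summit.BirchSwinnertonDyer.BirchSwinnertonDyer.Theorems.IwasawaTwoVariable

section TwoNil

variable {S : Type*} [AddCommGroup S] {p : ℕ} [Fact p.Prime] {A : Type*} [AddCommGroup A]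

/-- The truncated action on `Hom(S, A)` factors through the truncated action on `S` itself:
`∑_i [T^i]f · x(ψ^i s) = x(∑_i [T^i]f · ψ^i s)`. [folklore] -/
theorem evalT_eq_apply_evalT_id (ψ : AddMonoid.End S) (N k : ℕ) (f : PowerSeries ℤ_[p])
    (x : S →+ A) (s : S) :
    IwasawaDual.evalT p ψ N k f x s =
      x (IwasawaDual.evalT p ψ N k f (AddMonoidHom.id S) s) := by
  rw [IwasawaDual.evalT_def, IwasawaDual.evalT_def, map_sum]
  refine Finset.sum_congr rfl fun i _ => ?_
  rw [IwasawaDual.zpT_def, IwasawaDual.zpT_def, AddMonoidHom.id_apply, map_nsmul]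

variable {ψ : AddMonoid.End S} (h : IwasawaDual.IsLocNil p ψ)
include h

/-- `(f • x) = x ∘ (f • id)` for the one-variable structure `IsLocNil.smulFun`. [folklore] -/
theorem smulFun_eq_apply_smulFun_id (f : PowerSeries ℤ_[p]) (x : S →+ A) (s : S) :
    h.smulFun f x s = x (h.smulFun f (AddMonoidHom.id S) s) := by
  rw [h.smulFun_apply f x (h.tN_spec s) (h.tk_spec s),
    h.smulFun_apply f (AddMonoidHom.id S) (h.tN_spec s) (h.tk_spec s)]
  exact evalT_eq_apply_evalT_id ψ _ _ f x s

/-- The action of `ℤ_p⟦T⟧` on `S` itself (`f ↦ f • id`) is multiplicative up to the order of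
composition: `(fg) • id = (g • id) ∘ (f • id)`. [folklore] -/
theorem smulFun_id_mul (f g : PowerSeries ℤ_[p]) :
    h.smulFun (f * g) (AddMonoidHom.id S) =
      (h.smulFun g (AddMonoidHom.id S)).comp (h.smulFun f (AddMonoidHom.id S)) := by
  letI := h.module (A := S)
  have hmul : h.smulFun (f * g) (AddMonoidHom.id S) =
      h.smulFun f (h.smulFun g (AddMonoidHom.id S)) := mul_smul f g (AddMonoidHom.id S)
  rw [hmul]
  ext s
  rw [smulFun_eq_apply_smulFun_id h f, AddMonoidHom.comp_apply]

/-- `ψ'` commuting with `ψ` commutes with every `f • id` (a "power series in `ψ`"). [folklore] -/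
theorem apply_smulFun_id_of_commute {ψ' : AddMonoid.End S} (hc : ψ' * ψ = ψ * ψ')
    (f : PowerSeries ℤ_[p]) (s : S) :
    ψ' (h.smulFun f (AddMonoidHom.id S) s) = h.smulFun f (AddMonoidHom.id S) (ψ' s) := by
  have hN : (ψ ^ h.tN s) (ψ' s) = 0 := by
    have e : ψ ^ h.tN s * ψ' = ψ' * ψ ^ h.tN s := (Commute.pow_right hc (h.tN s)).symm.eq
    have := congrArg (fun φ : AddMonoid.End S => φ s) e
    simp only [AddMonoid.End.coe_mul, Function.comp_apply] at this
    rw [this, h.tN_spec, map_zero]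
  have hk : p ^ h.tk s • ψ' s = 0 := by rw [← map_nsmul, h.tk_spec, map_zero]
  rw [h.smulFun_apply f _ (h.tN_spec s) (h.tk_spec s), h.smulFun_apply f _ hN hk,
    IwasawaDual.evalT_def, IwasawaDual.evalT_def, map_sum]
  refine Finset.sum_congr rfl fun i _ => ?_
  rw [IwasawaDual.zpT_def, IwasawaDual.zpT_def, map_nsmul, AddMonoidHom.id_apply,
    AddMonoidHom.id_apply]
  congr 1
  have e : ψ' * ψ ^ i = ψ ^ i * ψ' := (Commute.pow_right hc i).eq
  have := congrArg (fun φ : AddMonoid.End S => φ s) e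
  simpa only [AddMonoid.End.coe_mul, Function.comp_apply] using this

omit h in
/-- **Two commuting locally nilpotent endomorphisms of a `p`-primary group give a
`ℤ_p⟦T₂⟧⟦T₁⟧ = PowerSeries (PowerSeries ℤ_[p])`-module structure on `Hom(S, A)`** with
`(T₁ • x) s = x (ψ₁ s)`, `(C T₂ • x) s = x (ψ₂ s)` and `(C (C c) • x) s = (c mod p^k) • x s` for
`p^k s = 0` — the three axioms of `Rubin1991.DualData₂`. The iterated one-variable construction
(module docstring). [folklore] -/
theorem exists_module₂ {ψ₁ ψ₂ : AddMonoid.End S} (h₁ : IwasawaDual.IsLocNil p ψ₁)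
    (h₂ : IwasawaDual.IsLocNil p ψ₂) (hc : ψ₁ * ψ₂ = ψ₂ * ψ₁) (A : Type*) [AddCommGroup A] :
    ∃ inst : Module (PowerSeries (PowerSeries ℤ_[p])) (S →+ A),
      (∀ (x : S →+ A) (s : S),
        (letI := inst; (PowerSeries.X : PowerSeries (PowerSeries ℤ_[p])) • x) s = x (ψ₁ s)) ∧
      (∀ (x : S →+ A) (s : S),
        (letI := inst;
          (PowerSeries.C (PowerSeries.X : PowerSeries ℤ_[p]) : PowerSeries (PowerSeries ℤ_[p])) •
            x) s = x (ψ₂ s)) ∧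
      (∀ (c : ℤ_[p]) (x : S →+ A) (s : S) (k : ℕ), p ^ k • s = 0 →
        (letI := inst;
          (PowerSeries.C (PowerSeries.C c : PowerSeries ℤ_[p]) : PowerSeries (PowerSeries ℤ_[p])) •
            x) s = (PadicInt.toZModPow k c).val • x s) := by
  -- the ring action of `B = ℤ_p⟦T₂⟧` on `S` itself through `ψ₂`
  let σ : PowerSeries ℤ_[p] →+* AddMonoid.End S :=
    { toFun := fun f => h₂.smulFun f (AddMonoidHom.id S)
      map_one' := by
        ext s
        show h₂.smulFun 1 (AddMonoidHom.id S) s = s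
        rw [h₂.smulFun_apply 1 _ (h₂.tN_spec s) (h₂.tk_spec s),
          IwasawaDual.evalT_one _ (h₂.tN_spec s) (h₂.tk_spec s)]
        rfl
      map_mul' := fun f g => by
        rw [mul_comm f g, smulFun_id_mul h₂ g f]
        rfl
      map_zero' := by
        letI := h₂.module (A := S)
        exact zero_smul (PowerSeries ℤ_[p]) (AddMonoidHom.id S)
      map_add' := fun f g => by
        letI := h₂.module (A := S)
        exact add_smul f g (AddMonoidHom.id S) }
  have hσ : ∀ f : PowerSeries ℤ_[p], σ f = h₂.smulFun f (AddMonoidHom.id S) := fun f => rfl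
  have hcomm : ∀ f : PowerSeries ℤ_[p], ψ₁ * σ f = σ f * ψ₁ := fun f => by
    ext s
    rw [AddMonoid.End.coe_mul, AddMonoid.End.coe_mul, Function.comp_apply, Function.comp_apply, hσ]
    exact apply_smulFun_id_of_commute h₂ hc f s
  obtain ⟨inst, -, hX, hC⟩ := IwasawaDualCoeff.exists_module (σ := σ) (ψ := ψ₁) hcomm h₁.nil A
  refine ⟨inst, hX, fun x s => ?_, fun c x s k hk => ?_⟩
  · rw [hC]
    show x (h₂.smulFun PowerSeries.X (AddMonoidHom.id S) s) = _
    rw [h₂.smulFun_X_apply]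
    rfl
  · rw [hC]
    show x (h₂.smulFun (PowerSeries.C c) (AddMonoidHom.id S) s) = _
    rw [h₂.smulFun_C_apply c _ hk, AddMonoidHom.id_apply, map_nsmul]

end TwoNil

end Summit.BirchSwinnertonDyer.BirchSwinnertonDyer.Theorems.IwasawaTwoVariable

end
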